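import Literature.Analysis.FluidPDE.TaoEnstrophyExteriorHolds
import Literature.Analysis.FluidPDE.TaoLocalisationHolds
import Literature.Analysis.FluidPDE.NSSerrinRegularityProofs
import Literature.Analysis.FluidPDE.ClassicalSolutionGlue
import HarnessLib

/-!
# Shelf crux `EnstrophyQuarterLaw` (stmt-NavierStokesRegularity-1574), line «sparse_sieve»:
# the FAR-FIELD ENSTROPHY piece `stub_farFieldEnstrophy`

Theorems file (seat ns-lqd-p2 g7, cell ns-idea-3 — the quarter law is the shared residual of the
routes `LerayQuarterDissipation`, `QuarterLogPincer`, `CalmSliceGate`; `--supports` the shelf crux).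
Navier–Stokes regularity is NOT proved by anything here; the quarter law itself stays OPEN (its
open stubs `stub_uniformLocalTypeI`, `stub_uniformSparseness` are untouched).

`stub_farFieldEnstrophy` proves, with the conclusion `FarFieldEnstrophy T u` of the registered stub
`stub_farFieldEnstrophy` of the skeleton `Cruxes/EnstrophyQuarterLaw/Lines/sparse_sieve.lean`
UNFOLDED VERBATIM (the predicate lives in the skeleton module, which a Theorems file cannot import;
the stub closes by `exact stub_farFieldEnstrophy …` there):

  for a maximal classical solution `u` on `[0, T)` (`ν, T > 0`), Leray–Hopf from its rapidly
  decaying datum, there are `ρ` and `B ≥ 0` with `∫_{ℝ³ ∖ B(0,ρ)} |curl u(t)|² ≤ B` for all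
  `t ∈ [T/2, T)` — **the enstrophy cannot blow up at spatial infinity**.

Proof (Tao 2011/2013, Thm. 10.1 in the exterior form of Remark 10.6 — the tree-PROVED fact
`tao2011_enstrophyLocalisation_exterior_holds` — run from the smooth slice `u(T/2)`):
the slice `u(T/2)` has finite enstrophy (Tao's Sobolev cover `tao2011_hasBoundedSobolevNormsOn_holds`
on `[0, T/2]` and `|curl v| ≤ ‖curl‖ |Dv|`), so for the `δ = δ(ν, T, E₀)` of the smallness condition
(78) and the `r = r(ν, T, E₀, δ)` of (79), both chosen for the FULL remaining length `T/2`, continuity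
from above (`exists_setLIntegral_compl_ball_le`) gives `R > 2r` with `∫_{ℝ³∖B(0,R)} |curl u(T/2)|² ≤ δ²`;
for each `t ∈ [T/2, T)` the translated solution `s ↦ u(s + T/2)` is classical on the CLOSED slab
`[0, T' − T/2]`, `T' = (t+T)/2 < T`, with energy `≤ 2E₀` (Leray–Hopf energy inequality), and the fact
bounds `∫_{ℝ³∖B(0,R+r)} |curl u(t)|² ≤ (Aδ)²` with `A = A(ν)` — uniformly in `t`, because `δ, r, R`
do not depend on `T'`.

References: T. Tao, *Localisation and compactness properties of the Navier–Stokes global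
regularity problem*, Anal. PDE 6 (2013) = arXiv:1108.1165v4, Thm. 10.1 (p. 54), Remark 10.6
(pp. 63–64), proof of Cor. 11.1 (p. 68).
-/

noncomputable section

-- the summit and its single sub-problem share the name (CONVENTIONS §1), as in every Theorems file
set_option linter.dupNamespace false

namespace Summit.NavierStokesRegularity.NavierStokesRegularity.Theorems.EnstrophyQuarterLaw.SparseSieve

open MeasureTheory Set Filter Topology Metric Function
open Literature.Analysis Literature.Analysis.FluidPDE
open scoped ENNReal NNReal

/-- **Finite enstrophy of every slice before the blow-up time** (Tao's Sobolev cover): for a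
classical solution on `[0, T)`, Leray–Hopf from a rapidly decaying datum, `∫ |curl u(t₁)|² < ∞` for
every `0 < t₁ < T`. [cite: Tao2011, Cor. 11.1 (proof)] -/
theorem lintegral_curl_sq_lt_top {ν T : ℝ} (hν : 0 < ν)
    {u : ℝ → EuclideanSpace ℝ (Fin 3) → EuclideanSpace ℝ (Fin 3)}
    {p : ℝ → EuclideanSpace ℝ (Fin 3) → ℝ}
    (hcl : IsClassicalNSSolutionOn (Ico 0 T) ν 0 u p) (hLH : IsLerayHopfOn T ν 0 (u 0) u)
    (hdec : HasRapidSpatialDecay (u 0)) {t₁ : ℝ} (ht₁ : 0 < t₁) (ht₁T : t₁ < T) :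
    ∫⁻ x, ‖curl (u t₁) x‖ₑ ^ 2 < ⊤ := by
  have hcl₁ : IsClassicalNSSolutionOn (Icc 0 t₁) ν 0 u p :=
    hcl.mono (fun s hs => ⟨hs.1, lt_of_le_of_lt hs.2 ht₁T⟩) (uniqueDiffOn_Icc ht₁)
  have hfe : ∃ C' : ℝ≥0, ∀ s ∈ Icc 0 t₁, ∫⁻ x, ‖u s x‖ₑ ^ 2 ≤ C' := by
    refine ⟨(2 * VectorCalculus.kineticEnergy (u 0)).toNNReal, fun s hs => ?_⟩
    have h := hLH.eEnergy_le_datum hν.le (t := s) ⟨hs.1, hs.2.trans ht₁T.le⟩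
    exact h
  have hSob := tao2011_hasBoundedSobolevNormsOn_holds hν ht₁ hcl₁ hfe hdec
  obtain ⟨C₁, hC₁⟩ := hSob 1
  have h1 : ∫⁻ x, ‖iteratedFDeriv ℝ 1 (u t₁) x‖ₑ ^ 2 < ⊤ :=
    lt_of_le_of_lt (hC₁ t₁ ⟨ht₁.le, le_rfl⟩) ENNReal.coe_lt_top
  refine lt_of_le_of_lt (lintegral_curl_sq_le (u t₁)) ?_
  exact ENNReal.mul_lt_top ENNReal.ofReal_lt_top h1

/-- **Far-field enstrophy bound on the second half of the life span** — the registered stub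
`stub_farFieldEnstrophy` of line «sparse_sieve» on the shelf crux `EnstrophyQuarterLaw`
(stmt-NavierStokesRegularity-1574) with its conclusion `FarFieldEnstrophy T u` unfolded verbatim:
for a maximal classical solution on `[0, T)`, Leray–Hopf from a rapidly decaying datum, there are
`ρ` and `B ≥ 0` with `∫_{ℝ³∖B(0,ρ)} |curl u(t)|² ≤ B` for all `t ∈ [T/2, T)` (Tao's enstrophy
localisation in the exterior form, applied from the slice `u(T/2)` on the closed slabs
`[T/2, T'] ⊂ [0,T)` with constants chosen for the full length `T/2`). [cite: Tao2011, Thm. 10.1 + Remark 10.6 (arXiv:1108.1165v4 pp. 54, 63–64)] -/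
theorem stub_farFieldEnstrophy : ∀ (ν T : ℝ), 0 < ν → 0 < T →
    ∀ (u : ℝ → EuclideanSpace ℝ (Fin 3) → EuclideanSpace ℝ (Fin 3))
      (p : ℝ → EuclideanSpace ℝ (Fin 3) → ℝ),
    IsMaximalSmoothSolution ν 0 u p T → IsLerayHopfOn T ν 0 (u 0) u →
    HasRapidSpatialDecay (u 0) →
    ∃ ρ B : ℝ, 0 ≤ B ∧ ∀ t ∈ Set.Ico (T / 2) T,
      ∫⁻ x in (Metric.ball (0 : EuclideanSpace ℝ (Fin 3)) ρ)ᶜ, ‖curl (u t) x‖ₑ ^ 2 ≤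
        ENNReal.ofReal B := by
  intro ν T hν hT u p hmax hLH hdec
  have hcl : IsClassicalNSSolutionOn (Ico 0 T) ν 0 u p := hmax.1
  -- ## data: energy, the slice `u(T/2)`
  set T₁ : ℝ := T / 2 with hT₁
  have hT₁pos : 0 < T₁ := by rw [hT₁]; positivity
  have hT₁T : T₁ < T := by rw [hT₁]; linarith
  set E₀ : ℝ := VectorCalculus.kineticEnergy (u 0) with hE₀
  have hE₀nn : 0 ≤ E₀ := kineticEnergy_nonneg _
  have hen : ∀ s ∈ Icc 0 T, ∫⁻ x, ‖u s x‖ₑ ^ 2 ≤ ENNReal.ofReal (2 * E₀) := fun s hs =>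
    hLH.eEnergy_le_datum hν.le hs
  have hcurl := lintegral_curl_sq_lt_top hν hcl hLH hdec hT₁pos hT₁T
  -- ## the constants of Tao's theorem, chosen for the full length `T₁`
  obtain ⟨c, C, A, hc, hC, hA, hfact⟩ := tao2011_enstrophyLocalisation_exterior_holds hν
  set S : ℝ := Real.sqrt E₀ with hS
  have hS0 : 0 ≤ S := Real.sqrt_nonneg _
  set δ : ℝ := min 1 (c / (T₁ * (1 + S))) with hδ
  have hδpos : 0 < δ := by rw [hδ]; exact lt_min one_pos (by positivity)
  have hδ1 : δ ≤ 1 := min_le_left _ _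
  have hδc : δ ≤ c / (T₁ * (1 + S)) := min_le_right _ _
  set r : ℝ := C * (E₀ + S * T₁ ^ (1 / 4 : ℝ) + δ⁻¹ ^ 2) + 1 with hr
  have hrpos : 0 < r := by rw [hr]; positivity
  -- ## `R > 2r` with small initial exterior vorticity
  obtain ⟨R, h2rR, hω₀⟩ := exists_setLIntegral_compl_ball_le hcurl
    (ε := ENNReal.ofReal (δ ^ 2)) (by exact ENNReal.ofReal_pos.2 (by positivity)) (2 * r)
  have hrR : r < R / 2 := by linarith
  refine ⟨R + r, (A * δ) ^ 2, sq_nonneg _, fun t ht => ?_⟩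
  -- ## the closed slab `[T₁, T']`, `T' = (t + T)/2`, translated to `[0, L]`
  set L : ℝ := (t + T) / 2 - T₁ with hL
  have hLpos : 0 < L := by rw [hL, hT₁]; linarith [ht.1, ht.2]
  have hLT₁ : L ≤ T₁ := by rw [hL, hT₁]; linarith [ht.2]
  have htL : t - T₁ ∈ Icc 0 L := ⟨by linarith [ht.1], by rw [hL]; linarith [ht.2]⟩
  set v : ℝ → EuclideanSpace ℝ (Fin 3) → EuclideanSpace ℝ (Fin 3) := fun s => u (s + T₁) with hv
  set q : ℝ → EuclideanSpace ℝ (Fin 3) → ℝ := fun s => p (s + T₁) with hq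
  have hsolv : IsClassicalNSSolutionOn (Icc 0 L) ν 0 v q :=
    (hcl.comp_add_right T₁).mono
      (fun s hs => ⟨by linarith [hs.1], by rw [hL] at hs; linarith [hs.2, ht.2]⟩)
      (uniqueDiffOn_Icc hLpos)
  have hfev : ∃ C' : ℝ≥0, ∀ s ∈ Icc 0 L, ∫⁻ x, ‖v s x‖ₑ ^ 2 ≤ C' := by
    refine ⟨(2 * E₀).toNNReal, fun s hs => ?_⟩
    have hs' : s + T₁ ∈ Icc 0 T := ⟨by linarith [hs.1], by linarith [hs.2]⟩
    exact hen (s + T₁) hs'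
  have hEv : ∫⁻ x, ‖v 0 x‖ₑ ^ 2 ≤ ENNReal.ofReal (2 * E₀) := by
    have h := hen T₁ ⟨hT₁pos.le, hT₁T.le⟩
    rw [hv]; dsimp only; rw [zero_add]; exact h
  have hω₀v : ∫⁻ x in (ball (0 : EuclideanSpace ℝ (Fin 3)) R)ᶜ, ‖curl (v 0) x‖ₑ ^ 2 ≤
      ENNReal.ofReal (δ ^ 2) := by
    rw [hv]; dsimp only; rw [zero_add]; exact hω₀
  -- ## the two size conditions hold on the shorter slab
  have hsmall : δ ^ 4 * L + δ ^ 5 * Real.sqrt E₀ * L ≤ c := by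
    rw [← hS]
    have h4 : δ ^ 4 ≤ δ := pow_le_of_le_one hδpos.le hδ1 (by norm_num)
    have h5 : δ ^ 5 ≤ δ := pow_le_of_le_one hδpos.le hδ1 (by norm_num)
    have h1 : δ ^ 4 * L ≤ δ * T₁ :=
      mul_le_mul h4 hLT₁ hLpos.le hδpos.le
    have h2 : δ ^ 5 * S * L ≤ δ * S * T₁ :=
      mul_le_mul (mul_le_mul_of_nonneg_right h5 hS0) hLT₁ hLpos.le (by positivity)
    have h3 : δ * T₁ + δ * S * T₁ = δ * (T₁ * (1 + S)) := by ring
    have hpos : 0 < T₁ * (1 + S) := by positivity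
    have h6 : δ * (T₁ * (1 + S)) ≤ c := by
      have := (le_div_iff₀ hpos).1 hδc
      linarith
    linarith
  have hlarge : C * (E₀ + Real.sqrt E₀ * L ^ (1 / 4 : ℝ) + δ⁻¹ ^ 2) < r := by
    rw [← hS, hr]
    have h1 : L ^ (1 / 4 : ℝ) ≤ T₁ ^ (1 / 4 : ℝ) := Real.rpow_le_rpow hLpos.le hLT₁ (by norm_num)
    have h2 : S * L ^ (1 / 4 : ℝ) ≤ S * T₁ ^ (1 / 4 : ℝ) := mul_le_mul_of_nonneg_left h1 hS0
    have h3 : C * (E₀ + S * L ^ (1 / 4 : ℝ) + δ⁻¹ ^ 2) ≤ C * (E₀ + S * T₁ ^ (1 / 4 : ℝ) + δ⁻¹ ^ 2) :=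
      mul_le_mul_of_nonneg_left (by linarith) hC.le
    linarith
  -- ## Tao's theorem on the slab, read at `s = t − T₁`
  obtain ⟨hslices, -⟩ := hfact hLpos hsolv hfev hE₀nn hEv (0 : EuclideanSpace ℝ (Fin 3)) hδpos
    hrpos hrR hω₀v hsmall hlarge
  have key := hslices (t - T₁) htL
  rw [hv] at key; dsimp only at key
  rw [sub_add_cancel] at key
  exact key

end Summit.NavierStokesRegularity.NavierStokesRegularity.Theorems.EnstrophyQuarterLaw.SparseSieve

end
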